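import Literature.NumberTheory.GaloisRepresentations.HeckeCharacterAutConj
import Literature.NumberTheory.GaloisRepresentations.LAdicCharacterIdelicValuesProofs
import Literature.NumberTheory.GaloisRepresentations.WeakAbelianDirectSummandTwistProofs
import HarnessLib

/-!
# Locally algebraic `ℓ`-adic characters come from algebraic Hecke characters (Weil, Serre; proved)

Topic `NumberTheory/GaloisRepresentations`; namespace
`Literature.NumberTheory.GaloisRepresentations`.  Proof file (theorems with auxiliary
constructions; no named fact, no instance, D-0026).  This is the direction
**(Loc-alg) ⇒ (E-SCS)** of Böckle–Hui §2.4 / Serre, *Abelian ℓ-adic representations*, Ch. III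
§2.3 (Thm. 2) with Ch. II §2.7 — "a locally algebraic abelian `ℓ`-adic representation comes from
an algebraic Hecke character" — for CHARACTERS, in the idelic rendering of local algebraicity used
by the tree (`LocallyAlgebraicLAdicCharacter.lean`): the companion, in the opposite direction, of
the tree's proof of Weil's theorem (`WeilLAdicCharacterProofs`: algebraic Hecke character ↦
`ℓ`-adic character).  It is the last step ("Hecke avatar", BH §3.2.1: "Since `τ_λ` is locally
algebraic by Theorem 1.1, it comes from an algebraic Hecke character `τ` of `K`") of the proof of
BH Thm. 1.1 in the form of the named fact `exists_heckeCharacter_of_weaklyDivides`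
(`WeakAbelianDirectSummand.lean`), for a general number field `K`.

## The statement (`exists_heckeCharacter_of_idelic_locallyAlgebraic`)

Let `K` be a number field, `ℓ` a prime, `ψ : Γ_K →ₜ* GL_1(ℚ̄_ℓ)` continuous, and
`Ψ : 𝕀_K →ₜ* ℚ̄_ℓˣ` an idelic avatar of `ψ` (`Ψ(Kˣ) = 1`; at almost all `v`: `Ψ(⟨𝒪_vˣ⟩) = 1` and
`ψ(Frob_v) = Ψ(⟨ϖ_v⟩)`), `L ⊇ S_ℓ` a finite set of places, and suppose `Ψ` is LOCALLY ALGEBRAIC at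
`L` with exponents `n : (K →+* ℚ̄_ℓ) → ℤ` and level `m`:
`∏_{v ∈ L} Ψ(⟨k⟩_v) = ∏_τ τ(k)^{-n_τ}` for every `k ∈ Kˣ` with `|k - 1|_v ≤ |ϖ_v|^m`, `v ∈ L`.
Then for every field isomorphism `ι : ℚ̄_ℓ ≃+* ℂ` there is an ALGEBRAIC Hecke character `χ` of `K`
with `χ`, `ψ` unramified and `ψ(Frob_v) = ι⁻¹(χ(ϖ_v))⁻¹` at all but finitely many `v` — the
conclusion of `exists_heckeCharacter_of_weaklyDivides` for `ψ`.

## The construction (Weil 1956 §1; Serre 1968 Ch. II §2.7, Ch. III §2.3)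

Serre/Weil twist `ψ ∘ Art` by the algebraic character `x ↦ ∏_τ τ̂(x_ℓ)^{n_τ}` of `(K ⊗ ℚ_ℓ)ˣ` to get
a locally constant character of `𝕀_K/Kˣ` with algebraic values on `Kˣ`, transport it along `ι`, and
twist back at infinity.  We avoid the local embeddings `τ̂ : K_v → ℚ̄_ℓ` (`v ∣ ℓ`) by evaluating the
twist on GLOBAL approximants, which is all local algebraicity (in the tree's global rendering)
controls:

* §2 `ellIdele L x = ∏_{v ∈ L} ⟨x_v⟩_v` (the `L`-part of an idele) and `IsClose L m x k`: the global
  `k ∈ Kˣ` is `m`-close to `x` at `L` (`|k x_v⁻¹ - 1|_v ≤ |ϖ_v|^m`); every idele has such a `k`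
  (`exists_isClose`, weak approximation `denseRange_algebraMap_pi_prod`).
* §3 `algFactor n k = ∏_τ τ(k)^{n_τ}` and the **correction** `corr x = Ψ(i_L(k)) · ∏_τ τ(k)^{n_τ}` for
  a chosen approximant `k` of `x` — INDEPENDENT of `k` by local algebraicity applied to quotients of
  approximants (`corr_eq_of_isClose`), hence multiplicative (`corr_mul`).
* §4 the **flattened character** `Ψ♭(x) = Ψ(x) Ψ(i_L(x))⁻¹ corr(x)` (`flatFun`): multiplicative,
  `Ψ♭((k)) = ∏_τ τ(k)^{n_τ}` on principal ideles (`flatFun_principalIdele`), `Ψ♭ = Ψ` on ideles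
  trivial at `L` (`flatFun_localUnits`, `flatFun_infiniteIdeles`), and **`Ψ♭ = 1` on a neighbourhood
  of `1`** (`eventually_flatFun_eq_one`: on totally positive `x_∞` the `ℓ`-adic `Ψ` is trivial —
  squares, `map_infiniteIdeles_sq_eq_one`; at the finitely many ramified `v ∤ ℓ` the kernel of
  `Ψ|𝒪_vˣ` is open — finite exponent `exists_pow_map_localUnits_eq_one_of_not_mem` and no small
  `ℓ`-adic roots of unity; at `v ∈ L` closeness to `1` makes `k = 1` an approximant).  So
  `ι ∘ Ψ♭ : 𝕀_K → ℂˣ` is a CONTINUOUS character (`flatHom`, `continuous_flatHom`).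
* §5 with `(p, q) = typeOfExponent (φ ↦ n_{ι⁻¹ ∘ φ})` (tree `HeckeCharacter.typeOfExponent`,
  `embExponent`, `archIdeleChar`): **`χ₀ = (ι ∘ Ψ♭) · A_{p,q}((·)_∞)` is a Hecke character**
  (`heckeOfLocAlg`): on `k ∈ Kˣ`, `ι(∏_τ τ(k)^{n_τ}) · ∏_φ φ(k)^{-n_{ι⁻¹φ}} = 1`
  (`archFactor_globalToInfiniteUnits_eq_prod_embeddings`, reindexing `τ ↦ ι ∘ τ`); it has infinity
  type `(p, q)` (`Ψ♭ = 1` near `1`), is unramified wherever `Ψ` is off `L`, with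
  `χ₀(ϖ_v) = ι(Ψ(⟨ϖ_v⟩)) = ι(ψ(Frob_v))`.
* §6 `χ = χ₀⁻¹` (algebraic, `HeckeCharacter.IsAlgebraic.inv`) has `ψ(Frob_v) = ι⁻¹(χ(ϖ_v))⁻¹`.

## References

* [BockleHui2025] G. Böckle, C.-Y. Hui, Math. Ann. 393 (2025), §2.3–2.4 ((Loc-alg) ⇒ (E-SCS)),
  §3.2.1.
* [SerreAbelianLadic1968] J.-P. Serre, *Abelian ℓ-adic representations and elliptic curves* (1968),
  Ch. II §2.7 (the Hecke character of a locally algebraic representation), Ch. III §2.3 Thm. 2.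
* [Weil1956] A. Weil, *On a certain type of characters of the idèle-class group of an algebraic
  number-field* (1956), §1 (characters of type `A₀` and their `λ`-adic avatars).
* [CasselsFrohlichANT1967] Ch. II §6 (weak approximation) — via `HeckeCharacterWeakApproximation`.
-/

noncomputable section

open scoped NumberField Topology Polynomial
open NumberField IsDedekindDomain IsDedekindDomain.HeightOneSpectrum Filter Field

namespace Literature.NumberTheory.GaloisRepresentations

variable {K : Type} [Field K] [NumberField K] {ℓ : ℕ} [Fact ℓ.Prime]

/-! ### §1. Congruences `|a - 1|_v ≤ γ < 1` in `K_v` -/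

section Valuation

variable {v : HeightOneSpectrum (𝓞 K)}

/-- `|a - 1| < 1 ⇒ |a| = 1`. [folklore] -/
theorem valued_eq_one_of_valued_sub_one_lt_one {a : v.adicCompletion K}
    (h : Valued.v (a - 1) < 1) : Valued.v a = 1 := by
  have := Valuation.map_one_add_of_lt Valued.v h
  rwa [add_sub_cancel] at this

/-- The congruence `|· - 1| ≤ γ` (`γ < 1`) is stable under products. [folklore] -/
theorem valued_mul_sub_one_le {a b : v.adicCompletion K} {γ : WithZero (Multiplicative ℤ)}
    (ha : Valued.v (a - 1) ≤ γ) (hb : Valued.v (b - 1) ≤ γ) (hγ : γ < 1) :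
    Valued.v (a * b - 1) ≤ γ := by
  have ha1 : Valued.v a = 1 := valued_eq_one_of_valued_sub_one_lt_one (ha.trans_lt hγ)
  have e : a * b - 1 = a * (b - 1) + (a - 1) := by ring
  rw [e]
  refine (Valuation.map_add _ _ _).trans (max_le ?_ ha)
  rw [Valuation.map_mul, ha1, one_mul]
  exact hb

/-- The congruence `|· - 1| ≤ γ` (`γ < 1`) is stable under inverses. [folklore] -/
theorem valued_inv_sub_one_le {a : v.adicCompletion K} {γ : WithZero (Multiplicative ℤ)}
    (ha : Valued.v (a - 1) ≤ γ) (hγ : γ < 1) : Valued.v (a⁻¹ - 1) ≤ γ := by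
  have ha1 : Valued.v a = 1 := valued_eq_one_of_valued_sub_one_lt_one (ha.trans_lt hγ)
  have ha0 : a ≠ 0 := fun h => by
    rw [h, map_zero] at ha1
    exact zero_ne_one ha1
  have e : a⁻¹ - 1 = -(a⁻¹ * (a - 1)) := by
    field_simp
    ring
  rw [e, Valuation.map_neg, Valuation.map_mul, map_inv₀, ha1, inv_one, one_mul]
  exact ha

/-- The congruence `|· - 1| ≤ γ` (`γ < 1`) is stable under quotients. [folklore] -/
theorem valued_mul_inv_sub_one_le {a b : v.adicCompletion K} {γ : WithZero (Multiplicative ℤ)}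
    (ha : Valued.v (a - 1) ≤ γ) (hb : Valued.v (b - 1) ≤ γ) (hγ : γ < 1) :
    Valued.v (b * a⁻¹ - 1) ≤ γ :=
  valued_mul_sub_one_le hb (valued_inv_sub_one_le ha hγ) hγ

/-- `|ϖ|^m < 1` for `m ≥ 1`. [folklore] -/
theorem withZero_exp_neg_lt_one {m : ℕ} (hm : 0 < m) : WithZero.exp (-(m : ℤ)) < 1 := by
  rw [← WithZero.exp_zero, WithZero.exp_lt_exp]
  omega

end Valuation

/-! ### §2. The `L`-part of an idele and global approximants -/

section LPart

/-- The `v`-component of an idele as a unit of `K_v`. [folklore] -/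
def ideleCpt (v : HeightOneSpectrum (𝓞 K)) : ideleGroup K →* (v.adicCompletion K)ˣ where
  toFun x := Units.mk0 ((x : AdeleRing (𝓞 K) K).2 v) (ideleGroup_snd_ne_zero x v)
  map_one' := Units.ext rfl
  map_mul' x y := Units.ext (ideleGroup_val_snd_mul x y v)

/-- Unfolding `ideleCpt`. [folklore] -/
@[simp] theorem val_ideleCpt (v : HeightOneSpectrum (𝓞 K)) (x : ideleGroup K) :
    ((ideleCpt v x : (v.adicCompletion K)ˣ) : v.adicCompletion K) = (x : AdeleRing (𝓞 K) K).2 v :=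
  rfl

/-- The component of a principal idele is the global element. [folklore] -/
theorem ideleCpt_principalIdele (v : HeightOneSpectrum (𝓞 K)) (k : Kˣ) :
    ideleCpt v (principalIdele K k) = globalToLocalUnits v k :=
  Units.ext (by rw [val_ideleCpt, principalIdele_snd, val_globalToLocalUnits])

variable (L : Finset (HeightOneSpectrum (𝓞 K)))

/-- The **`L`-part** `i_L(x) = ∏_{v ∈ L} ⟨x_v⟩_v` of an idele: the idele with the components of
`x` at the places of `L` and `1` elsewhere (for `L = S_ℓ` this is BH's `i_ℓ(x_ℓ)`, §2.3). [folklore] -/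
def ellIdele (x : ideleGroup K) : ideleGroup K := ∏ v ∈ L, localUnits v (ideleCpt v x)

/-- `i_L` is multiplicative. [folklore] -/
theorem ellIdele_mul (x y : ideleGroup K) : ellIdele L (x * y) = ellIdele L x * ellIdele L y := by
  simp only [ellIdele, map_mul, Finset.prod_mul_distrib]

/-- `i_L(1) = 1`. [folklore] -/
@[simp] theorem ellIdele_one : ellIdele L (1 : ideleGroup K) = 1 := by
  simp only [ellIdele, map_one, Finset.prod_const_one]

/-- The `L`-part of a principal idele. [folklore] -/
theorem ellIdele_principalIdele (k : Kˣ) :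
    ellIdele L (principalIdele K k) = ∏ v ∈ L, localUnits v (globalToLocalUnits v k) := by
  simp only [ellIdele, ideleCpt_principalIdele]

open scoped Classical in
/-- Finite components of `i_L(x)`. [folklore] -/
theorem snd_ellIdele (x : ideleGroup K) (w : HeightOneSpectrum (𝓞 K)) :
    ((ellIdele L x : ideleGroup K) : AdeleRing (𝓞 K) K).2 w =
      if w ∈ L then (x : AdeleRing (𝓞 K) K).2 w else 1 := by
  classical
  rw [ellIdele, snd_prod_localUnits L (fun q => ideleCpt q x) w]
  split_ifs <;> rfl

/-- The infinite component of `i_L(x)` is `1`. [folklore] -/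
theorem fst_ellIdele (x : ideleGroup K) :
    ((ellIdele L x : ideleGroup K) : AdeleRing (𝓞 K) K).1 = 1 :=
  fst_prod_localUnits L (fun q => ideleCpt q x)

/-- `i_L(x) = 1` when `x_v = 1` for all `v ∈ L`. [folklore] -/
theorem ellIdele_eq_one_of_snd_eq_one {x : ideleGroup K}
    (hx : ∀ v ∈ L, (x : AdeleRing (𝓞 K) K).2 v = 1) : ellIdele L x = 1 := by
  refine Finset.prod_eq_one fun v hv => ?_
  have : ideleCpt v x = 1 := Units.ext (by rw [val_ideleCpt, hx v hv, Units.val_one])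
  rw [this, map_one]

variable (m : ℕ)

/-- **`k ∈ Kˣ` is `m`-close to the idele `x` at `L`**: `|k x_v⁻¹ - 1|_v ≤ |ϖ_v|^m` for `v ∈ L`.
[folklore] -/
def IsClose (x : ideleGroup K) (k : Kˣ) : Prop :=
  ∀ v ∈ L, Valued.v (algebraMap K (v.adicCompletion K) (k : K) * ((x : AdeleRing (𝓞 K) K).2 v)⁻¹ - 1) ≤
    WithZero.exp (-(m : ℤ))

variable {L m}

/-- Closeness is multiplicative. [folklore] -/
theorem IsClose.mul (hm : 0 < m) {x y : ideleGroup K} {k k' : Kˣ} (hx : IsClose L m x k)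
    (hy : IsClose L m y k') : IsClose L m (x * y) (k * k') := by
  intro v hv
  have e : algebraMap K (v.adicCompletion K) ((k * k' : Kˣ) : K) *
      (((x * y : ideleGroup K) : AdeleRing (𝓞 K) K).2 v)⁻¹ =
      (algebraMap K (v.adicCompletion K) (k : K) * ((x : AdeleRing (𝓞 K) K).2 v)⁻¹) *
        (algebraMap K (v.adicCompletion K) (k' : K) * ((y : AdeleRing (𝓞 K) K).2 v)⁻¹) := by
    rw [ideleGroup_val_snd_mul, Units.val_mul, map_mul, mul_inv]
    ring
  rw [e]
  exact valued_mul_sub_one_le (hx v hv) (hy v hv) (withZero_exp_neg_lt_one hm)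

/-- Two approximants of the same idele are congruent: `|k'/k - 1|_v ≤ |ϖ_v|^m` on `L`. [folklore] -/
theorem IsClose.valued_div_sub_one_le (hm : 0 < m) {x : ideleGroup K} {k k' : Kˣ}
    (hk : IsClose L m x k) (hk' : IsClose L m x k') :
    ∀ v ∈ L, Valued.v (algebraMap K (v.adicCompletion K) ((k' * k⁻¹ : Kˣ) : K) - 1) ≤
      WithZero.exp (-(m : ℤ)) := by
  intro v hv
  have hx0 : (x : AdeleRing (𝓞 K) K).2 v ≠ 0 := ideleGroup_snd_ne_zero x v
  have hk0 : algebraMap K (v.adicCompletion K) (k : K) ≠ 0 := (_root_.map_ne_zero _).mpr k.ne_zero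
  have e : algebraMap K (v.adicCompletion K) ((k' * k⁻¹ : Kˣ) : K) =
      (algebraMap K (v.adicCompletion K) (k' : K) * ((x : AdeleRing (𝓞 K) K).2 v)⁻¹) *
        (algebraMap K (v.adicCompletion K) (k : K) * ((x : AdeleRing (𝓞 K) K).2 v)⁻¹)⁻¹ := by
    rw [Units.val_mul, Units.val_inv_eq_inv_val, map_mul, map_inv₀]
    field_simp
  rw [e]
  exact valued_mul_inv_sub_one_le (hk v hv) (hk' v hv) (withZero_exp_neg_lt_one hm)

/-- A principal idele is approximated by its own generator. [folklore] -/
theorem isClose_principalIdele (k : Kˣ) : IsClose L m (principalIdele K k) k := by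
  intro v _
  have hk0 : algebraMap K (v.adicCompletion K) (k : K) ≠ 0 := (_root_.map_ne_zero _).mpr k.ne_zero
  rw [principalIdele_snd, mul_inv_cancel₀ hk0, sub_self, map_zero]
  exact zero_le

/-- An idele congruent to `1` at `L` is approximated by `k = 1`. [folklore] -/
theorem isClose_one_of_valued_sub_one_le (hm : 0 < m) {x : ideleGroup K}
    (hx : ∀ v ∈ L, Valued.v ((x : AdeleRing (𝓞 K) K).2 v - 1) ≤ WithZero.exp (-(m : ℤ))) :
    IsClose L m x 1 := by
  intro v hv
  rw [Units.val_one, map_one, one_mul]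
  exact valued_inv_sub_one_le (hx v hv) (withZero_exp_neg_lt_one hm)

variable (L m) in
/-- **Every idele has a global `m`-approximant at `L`** (weak approximation at the finitely many
places of `L`, tree `denseRange_algebraMap_pi_prod`). [cite: CasselsFrohlichANT1967, Ch. II §6 Lemma] -/
theorem exists_isClose (hm : 0 < m) (x : ideleGroup K) : ∃ k : Kˣ, IsClose L m x k := by
  classical
  rcases L.eq_empty_or_nonempty with hL | hL
  · exact ⟨1, fun v hv => by simp [hL] at hv⟩
  set γ : WithZero (Multiplicative ℤ) := WithZero.exp (-(m : ℤ)) with hγ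
  have hγ1 : γ < 1 := withZero_exp_neg_lt_one hm
  -- the target neighbourhood in `∏_{v ∈ L} K_v × (K ⊗ ℝ)`
  set c : ∀ v : (L : Set (HeightOneSpectrum (𝓞 K))), v.1.adicCompletion K := fun v =>
    (x : AdeleRing (𝓞 K) K).2 v.1 with hc
  have hc0 : ∀ v : (L : Set (HeightOneSpectrum (𝓞 K))), c v ≠ 0 := fun v =>
    ideleGroup_snd_ne_zero x v.1
  set S : ∀ v : (L : Set (HeightOneSpectrum (𝓞 K))), Set (v.1.adicCompletion K) := fun v =>
    {a | Valued.v (a * (c v)⁻¹ - 1) < γ} with hS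
  have hSn : ∀ v : (L : Set (HeightOneSpectrum (𝓞 K))), S v ∈ 𝓝 (c v) := by
    intro v
    have hcont : Continuous fun a : v.1.adicCompletion K => a * (c v)⁻¹ :=
      continuous_id.mul continuous_const
    have h1 : {b : v.1.adicCompletion K | Valued.v (b - 1) < γ} ∈ 𝓝 ((c v) * (c v)⁻¹) := by
      rw [mul_inv_cancel₀ (hc0 v)]
      exact adicCompletion_setOf_valued_sub_one_lt_mem_nhds v.1 m
    exact hcont.continuousAt.preimage_mem_nhds h1
  have hO : (Set.pi Set.univ S) ×ˢ (Set.univ : Set (InfiniteAdeleRing K)) ∈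
      𝓝 ((fun v => c v, (1 : InfiniteAdeleRing K))) :=
    prod_mem_nhds (set_pi_mem_nhds Set.finite_univ fun v _ => hSn v) Filter.univ_mem
  obtain ⟨k, hk⟩ := (denseRange_algebraMap_pi_prod (K := K) L).mem_nhds hO
  simp only [Set.mem_prod, Set.mem_pi, Set.mem_univ, true_imp_iff, and_true] at hk
  -- `k ≠ 0` (as `L ≠ ∅` and `γ < 1`)
  have hk0 : k ≠ 0 := by
    rintro rfl
    obtain ⟨v, hv⟩ := hL
    have h := hk ⟨v, hv⟩
    simp only [hS, Set.mem_setOf_eq, map_zero, zero_mul, zero_sub, Valuation.map_neg,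
      Valuation.map_one] at h
    exact lt_irrefl _ (h.trans hγ1)
  refine ⟨Units.mk0 k hk0, fun v hv => ?_⟩
  have h := hk ⟨v, hv⟩
  simp only [hS, Set.mem_setOf_eq] at h
  rw [Units.val_mk0]
  exact h.le

end LPart

/-! ### §3. The algebraic factor `∏_τ τ(k)^{n_τ}` and the correction -/

section Correction

variable (Ψ : ideleGroup K →ₜ* (PadicAlgCl ℓ)ˣ) (L : Finset (HeightOneSpectrum (𝓞 K)))
  (n : (K →+* PadicAlgCl ℓ) → ℤ) (m : ℕ)

/-- The **algebraic factor** `r(k) = ∏_τ τ(k)^{n_τ}` over the ring embeddings `τ : K → ℚ̄_ℓ`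
(the algebraic character of `T_K = Res_{K/ℚ}𝔾_m` with exponents `n`, on `Kˣ`). [cite: BockleHui2025, §2.3] -/
def algFactor (k : Kˣ) : PadicAlgCl ℓ := ∏ τ : K →+* PadicAlgCl ℓ, τ (k : K) ^ n τ

/-- `r` is multiplicative. [folklore] -/
theorem algFactor_mul (k k' : Kˣ) : algFactor n (k * k') = algFactor n k * algFactor n k' := by
  simp only [algFactor, Units.val_mul, map_mul, mul_zpow, Finset.prod_mul_distrib]

/-- `r(1) = 1`. [folklore] -/
@[simp] theorem algFactor_one : algFactor n (1 : Kˣ) = 1 := by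
  simp [algFactor]

/-- `r(k) ≠ 0`. [folklore] -/
theorem algFactor_ne_zero (k : Kˣ) : algFactor n k ≠ 0 :=
  Finset.prod_ne_zero_iff.mpr fun τ _ => zpow_ne_zero _ ((_root_.map_ne_zero τ).mpr k.ne_zero)

/-- `r(k⁻¹) = r(k)⁻¹`. [folklore] -/
theorem algFactor_inv (k : Kˣ) : algFactor n k⁻¹ = (algFactor n k)⁻¹ :=
  eq_inv_of_mul_eq_one_left (by rw [← algFactor_mul, inv_mul_cancel, algFactor_one])

/-! The hypothesis of **local algebraicity at `L` with exponents `n` and level `m`** for an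
idelic character `Ψ : 𝕀_K →ₜ* ℚ̄_ℓˣ` — `∏_{v ∈ L} Ψ(⟨k⟩_v) = ∏_τ τ(k)^{-n_τ}` for all `k ∈ Kˣ` with
`|k - 1|_v ≤ |ϖ_v|^m` on `L` (the defining identity of `FramedGaloisRep.IsLocallyAlgebraic` for
`L = S_ℓ`, BH §2.3) — is spelled out in each statement below (hypothesis `hLA`). -/

variable {Ψ L n m}

/-- Under local algebraicity, `Ψ(i_L((k))) = r(k)⁻¹` for `k ≡ 1`. [folklore] -/
theorem coe_map_ellIdele_principalIdele_of_locAlg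
    (hLA : ∀ k : Kˣ, (∀ v ∈ L, Valued.v (algebraMap K (v.adicCompletion K) (k : K) - 1) ≤
        WithZero.exp (-(m : ℤ))) →
      (∏ v ∈ L, ((Ψ (localUnits v (globalToLocalUnits v k)) : (PadicAlgCl ℓ)ˣ) : PadicAlgCl ℓ)) =
        ∏ τ : K →+* PadicAlgCl ℓ, τ (k : K) ^ (-(n τ))) {k : Kˣ}
    (hk : ∀ v ∈ L, Valued.v (algebraMap K (v.adicCompletion K) (k : K) - 1) ≤ WithZero.exp (-(m : ℤ))) :
    ((Ψ (ellIdele L (principalIdele K k)) : (PadicAlgCl ℓ)ˣ) : PadicAlgCl ℓ) = (algFactor n k)⁻¹ := by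
  rw [ellIdele_principalIdele, map_prod, Units.coe_prod, hLA k hk, algFactor, ← Finset.prod_inv_distrib]
  refine Finset.prod_congr rfl fun τ _ => ?_
  rw [zpow_neg]

variable (Ψ L n m)

/-- A chosen global `m`-approximant of `x` at `L`. [folklore] -/
def approximant (hm : 0 < m) (x : ideleGroup K) : Kˣ := Classical.choose (exists_isClose L m hm x)

/-- The chosen approximant approximates. [folklore] -/
theorem isClose_approximant (hm : 0 < m) (x : ideleGroup K) :
    IsClose L m x (approximant L m hm x) :=
  Classical.choose_spec (exists_isClose L m hm x)

/-- The **correction factor** `corr(x) = Ψ(i_L((k))) · r(k)` for the chosen approximant `k` of `x`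
(independent of the choice, `corr_eq_of_isClose`). [cite: SerreAbelianLadic1968, Ch. II §2.7] -/
def corr (hm : 0 < m) (x : ideleGroup K) : PadicAlgCl ℓ :=
  ((Ψ (ellIdele L (principalIdele K (approximant L m hm x))) : (PadicAlgCl ℓ)ˣ) : PadicAlgCl ℓ) *
    algFactor n (approximant L m hm x)

variable {Ψ L n m}

/-- **The correction does not depend on the approximant**: for any `k` `m`-close to `x` at `L`,
`corr(x) = Ψ(i_L((k))) · r(k)` — two approximants differ by `q ≡ 1`, for which
`Ψ(i_L((q))) r(q) = 1` is local algebraicity. [cite: SerreAbelianLadic1968, Ch. II §2.7] -/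
theorem corr_eq_of_isClose {hm : 0 < m} (hLA : ∀ k : Kˣ, (∀ v ∈ L, Valued.v (algebraMap K (v.adicCompletion K) (k : K) - 1) ≤
        WithZero.exp (-(m : ℤ))) →
      (∏ v ∈ L, ((Ψ (localUnits v (globalToLocalUnits v k)) : (PadicAlgCl ℓ)ˣ) : PadicAlgCl ℓ)) =
        ∏ τ : K →+* PadicAlgCl ℓ, τ (k : K) ^ (-(n τ))) {x : ideleGroup K} {k : Kˣ}
    (hk : IsClose L m x k) :
    corr Ψ L n m hm x =
      ((Ψ (ellIdele L (principalIdele K k)) : (PadicAlgCl ℓ)ˣ) : PadicAlgCl ℓ) * algFactor n k := by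
  set k₀ := approximant L m hm x with hk₀def
  have hk₀ : IsClose L m x k₀ := isClose_approximant L m hm x
  -- `q = k k₀⁻¹ ≡ 1` on `L`
  have hq := hk₀.valued_div_sub_one_le hm hk
  have hΨq := coe_map_ellIdele_principalIdele_of_locAlg hLA hq
  have hP : principalIdele K k = principalIdele K (k * k₀⁻¹) * principalIdele K k₀ := by
    rw [← map_mul, inv_mul_cancel_right]
  have halg : algFactor n k = algFactor n (k * k₀⁻¹) * algFactor n k₀ := by
    rw [← algFactor_mul, inv_mul_cancel_right]
  have hq0 : algFactor n (k * k₀⁻¹) ≠ 0 := algFactor_ne_zero n _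
  change ((Ψ (ellIdele L (principalIdele K k₀)) : (PadicAlgCl ℓ)ˣ) : PadicAlgCl ℓ) * algFactor n k₀ = _
  rw [hP, ellIdele_mul, map_mul, Units.val_mul, hΨq, halg]
  field_simp

/-- The correction is multiplicative. [folklore] -/
theorem corr_mul {hm : 0 < m} (hLA : ∀ k : Kˣ, (∀ v ∈ L, Valued.v (algebraMap K (v.adicCompletion K) (k : K) - 1) ≤
        WithZero.exp (-(m : ℤ))) →
      (∏ v ∈ L, ((Ψ (localUnits v (globalToLocalUnits v k)) : (PadicAlgCl ℓ)ˣ) : PadicAlgCl ℓ)) =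
        ∏ τ : K →+* PadicAlgCl ℓ, τ (k : K) ^ (-(n τ))) (x y : ideleGroup K) :
    corr Ψ L n m hm (x * y) = corr Ψ L n m hm x * corr Ψ L n m hm y := by
  rw [corr_eq_of_isClose hLA ((isClose_approximant L m hm x).mul hm (isClose_approximant L m hm y)),
    map_mul, ellIdele_mul, map_mul, Units.val_mul, algFactor_mul]
  unfold corr
  ring

/-- The correction is `1` on ideles congruent to `1` at `L`. [folklore] -/
theorem corr_eq_one_of_isClose_one {hm : 0 < m} (hLA : ∀ k : Kˣ, (∀ v ∈ L, Valued.v (algebraMap K (v.adicCompletion K) (k : K) - 1) ≤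
        WithZero.exp (-(m : ℤ))) →
      (∏ v ∈ L, ((Ψ (localUnits v (globalToLocalUnits v k)) : (PadicAlgCl ℓ)ˣ) : PadicAlgCl ℓ)) =
        ∏ τ : K →+* PadicAlgCl ℓ, τ (k : K) ^ (-(n τ))) {x : ideleGroup K}
    (hx : IsClose L m x 1) : corr Ψ L n m hm x = 1 := by
  rw [corr_eq_of_isClose hLA hx, map_one, ellIdele_one, map_one, Units.val_one, algFactor_one, mul_one]

/-- The correction never vanishes. [folklore] -/
theorem corr_ne_zero (hm : 0 < m) (x : ideleGroup K) : corr Ψ L n m hm x ≠ 0 :=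
  mul_ne_zero (Units.ne_zero _) (algFactor_ne_zero n _)

end Correction

/-! ### §4. The flattened character `Ψ♭` -/

section Flat

variable (Ψ : ideleGroup K →ₜ* (PadicAlgCl ℓ)ˣ) (L : Finset (HeightOneSpectrum (𝓞 K)))
  (n : (K →+* PadicAlgCl ℓ) → ℤ) (m : ℕ)

/-- The **flattened character** `Ψ♭(x) = Ψ(x) · Ψ(i_L(x))⁻¹ · corr(x)`: `Ψ` with its `L`-part
replaced by the (locally constant) correction. [cite: SerreAbelianLadic1968, Ch. II §2.7] -/
def flatFun (hm : 0 < m) (x : ideleGroup K) : PadicAlgCl ℓ :=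
  ((Ψ x : (PadicAlgCl ℓ)ˣ) : PadicAlgCl ℓ) *
    (((Ψ (ellIdele L x) : (PadicAlgCl ℓ)ˣ) : PadicAlgCl ℓ))⁻¹ * corr Ψ L n m hm x

variable {Ψ L n m}

/-- `Ψ♭(x) ≠ 0`. [folklore] -/
theorem flatFun_ne_zero (hm : 0 < m) (x : ideleGroup K) : flatFun Ψ L n m hm x ≠ 0 :=
  mul_ne_zero (mul_ne_zero (Units.ne_zero _) (inv_ne_zero (Units.ne_zero _))) (corr_ne_zero hm x)

/-- `Ψ♭` is multiplicative. [folklore] -/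
theorem flatFun_mul {hm : 0 < m} (hLA : ∀ k : Kˣ, (∀ v ∈ L, Valued.v (algebraMap K (v.adicCompletion K) (k : K) - 1) ≤
        WithZero.exp (-(m : ℤ))) →
      (∏ v ∈ L, ((Ψ (localUnits v (globalToLocalUnits v k)) : (PadicAlgCl ℓ)ˣ) : PadicAlgCl ℓ)) =
        ∏ τ : K →+* PadicAlgCl ℓ, τ (k : K) ^ (-(n τ))) (x y : ideleGroup K) :
    flatFun Ψ L n m hm (x * y) = flatFun Ψ L n m hm x * flatFun Ψ L n m hm y := by
  simp only [flatFun, map_mul, ellIdele_mul, Units.val_mul, corr_mul hLA, mul_inv]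
  ring

/-- `Ψ♭(1) = 1`. [folklore] -/
theorem flatFun_one {hm : 0 < m} (hLA : ∀ k : Kˣ, (∀ v ∈ L, Valued.v (algebraMap K (v.adicCompletion K) (k : K) - 1) ≤
        WithZero.exp (-(m : ℤ))) →
      (∏ v ∈ L, ((Ψ (localUnits v (globalToLocalUnits v k)) : (PadicAlgCl ℓ)ˣ) : PadicAlgCl ℓ)) =
        ∏ τ : K →+* PadicAlgCl ℓ, τ (k : K) ^ (-(n τ))) : flatFun Ψ L n m hm 1 = 1 := by
  have h1 : IsClose L m (1 : ideleGroup K) 1 := by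
    have := isClose_principalIdele (L := L) (m := m) (1 : Kˣ)
    rwa [map_one] at this
  rw [flatFun, map_one, ellIdele_one, map_one, Units.val_one, inv_one, one_mul, one_mul]
  exact corr_eq_one_of_isClose_one hLA h1

/-- **`Ψ♭((k)) = ∏_τ τ(k)^{n_τ}` on principal ideles** (`Ψ((k)) = 1`, and `k` approximates `(k)`).
[cite: SerreAbelianLadic1968, Ch. II §2.7] -/
theorem flatFun_principalIdele {hm : 0 < m} (hLA : ∀ k : Kˣ, (∀ v ∈ L, Valued.v (algebraMap K (v.adicCompletion K) (k : K) - 1) ≤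
        WithZero.exp (-(m : ℤ))) →
      (∏ v ∈ L, ((Ψ (localUnits v (globalToLocalUnits v k)) : (PadicAlgCl ℓ)ˣ) : PadicAlgCl ℓ)) =
        ∏ τ : K →+* PadicAlgCl ℓ, τ (k : K) ^ (-(n τ)))
    (hK : ∀ x ∈ principalIdeles K, Ψ x = 1) (k : Kˣ) :
    flatFun Ψ L n m hm (principalIdele K k) = algFactor n k := by
  rw [flatFun, corr_eq_of_isClose hLA (isClose_principalIdele k), hK _ (principalIdele_mem k),
    Units.val_one, one_mul, inv_mul_cancel_left₀ (Units.ne_zero _)]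

/-- `Ψ♭ = Ψ` on ideles with trivial components at `L`. [folklore] -/
theorem flatFun_eq_of_snd_eq_one {hm : 0 < m} (hLA : ∀ k : Kˣ, (∀ v ∈ L, Valued.v (algebraMap K (v.adicCompletion K) (k : K) - 1) ≤
        WithZero.exp (-(m : ℤ))) →
      (∏ v ∈ L, ((Ψ (localUnits v (globalToLocalUnits v k)) : (PadicAlgCl ℓ)ˣ) : PadicAlgCl ℓ)) =
        ∏ τ : K →+* PadicAlgCl ℓ, τ (k : K) ^ (-(n τ))) {x : ideleGroup K}
    (hx : ∀ v ∈ L, (x : AdeleRing (𝓞 K) K).2 v = 1) :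
    flatFun Ψ L n m hm x = ((Ψ x : (PadicAlgCl ℓ)ˣ) : PadicAlgCl ℓ) := by
  have h1 : IsClose L m x 1 := fun v hv => by
    rw [hx v hv, inv_one, mul_one, Units.val_one, map_one, sub_self, map_zero]
    exact zero_le
  rw [flatFun, ellIdele_eq_one_of_snd_eq_one L hx, map_one, Units.val_one, inv_one, mul_one,
    corr_eq_one_of_isClose_one hLA h1, mul_one]

/-- `Ψ♭(⟨u⟩_v) = Ψ(⟨u⟩_v)` at a place `v ∉ L`. [folklore] -/
theorem flatFun_localUnits {hm : 0 < m} (hLA : ∀ k : Kˣ, (∀ v ∈ L, Valued.v (algebraMap K (v.adicCompletion K) (k : K) - 1) ≤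
        WithZero.exp (-(m : ℤ))) →
      (∏ v ∈ L, ((Ψ (localUnits v (globalToLocalUnits v k)) : (PadicAlgCl ℓ)ˣ) : PadicAlgCl ℓ)) =
        ∏ τ : K →+* PadicAlgCl ℓ, τ (k : K) ^ (-(n τ))) {v : HeightOneSpectrum (𝓞 K)}
    (hv : v ∉ L) (u : (v.adicCompletion K)ˣ) :
    flatFun Ψ L n m hm (localUnits v u) = ((Ψ (localUnits v u) : (PadicAlgCl ℓ)ˣ) : PadicAlgCl ℓ) :=
  flatFun_eq_of_snd_eq_one hLA fun _ hw =>
    localUnits_snd_apply_of_ne u (fun h => hv (h ▸ hw))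

/-- `Ψ♭((y, 1)) = Ψ((y, 1))` on infinite ideles. [folklore] -/
theorem flatFun_infiniteIdeles {hm : 0 < m} (hLA : ∀ k : Kˣ, (∀ v ∈ L, Valued.v (algebraMap K (v.adicCompletion K) (k : K) - 1) ≤
        WithZero.exp (-(m : ℤ))) →
      (∏ v ∈ L, ((Ψ (localUnits v (globalToLocalUnits v k)) : (PadicAlgCl ℓ)ˣ) : PadicAlgCl ℓ)) =
        ∏ τ : K →+* PadicAlgCl ℓ, τ (k : K) ^ (-(n τ))) (y : (InfiniteAdeleRing K)ˣ) :
    flatFun Ψ L n m hm (infiniteIdeles K y) =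
      ((Ψ (infiniteIdeles K y) : (PadicAlgCl ℓ)ˣ) : PadicAlgCl ℓ) :=
  flatFun_eq_of_snd_eq_one hLA fun w _ => infiniteIdeles_snd y w

/-- **An `ℓ`-adic idelic character is trivial on the totally positive infinite ideles** (they are
squares, `InfiniteIdele.exists_pow_eq_tendsto_one`, and `Ψ` kills squares,
`IdelicCharacter.map_infiniteIdeles_sq_eq_one`). [cite: SerreAbelianLadic1968, Ch. III §2.2] -/
theorem map_infiniteIdeles_eq_one_of_isTotallyPositive (Ψ : ideleGroup K →ₜ* (PadicAlgCl ℓ)ˣ)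
    {y : (InfiniteAdeleRing K)ˣ} (hy : InfiniteIdele.IsTotallyPositive y) :
    Ψ (infiniteIdeles K y) = 1 := by
  obtain ⟨r, hr, -⟩ := InfiniteIdele.exists_pow_eq_tendsto_one y hy
  rw [← hr 2 two_pos]
  exact IdelicCharacter.map_infiniteIdeles_sq_eq_one Ψ (r 2)

/-- Totally positive infinite ideles form a neighbourhood of `1`. [folklore] -/
theorem eventually_isTotallyPositive :
    ∀ᶠ y in 𝓝 (1 : (InfiniteAdeleRing K)ˣ), InfiniteIdele.IsTotallyPositive y := by
  have key : ∀ w : InfinitePlace K, ∀ hw : w.IsReal, ∀ᶠ y : (InfiniteAdeleRing K)ˣ in 𝓝 1,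
      0 < NumberField.InfinitePlace.Completion.extensionEmbeddingOfIsReal hw
        (((y : (InfiniteAdeleRing K)ˣ) : InfiniteAdeleRing K) w) := by
    intro w hw
    have hc : Continuous fun y : (InfiniteAdeleRing K)ˣ =>
        NumberField.InfinitePlace.Completion.extensionEmbeddingOfIsReal hw
          ((y : InfiniteAdeleRing K) w) :=
      (NumberField.InfinitePlace.Completion.isometry_extensionEmbeddingOfIsReal hw).continuous.comp
        ((continuous_apply w).comp Units.continuous_val)
    have h1 : NumberField.InfinitePlace.Completion.extensionEmbeddingOfIsReal hw
        (((1 : (InfiniteAdeleRing K)ˣ) : InfiniteAdeleRing K) w) = 1 := by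
      rw [Units.val_one, InfiniteAdeleRing.one_apply', map_one]
    have h2 : ∀ᶠ t in 𝓝 (1 : ℝ), 0 < t := Ioi_mem_nhds one_pos
    rw [← h1] at h2
    exact hc.continuousAt.eventually h2
  have hall : ∀ᶠ y : (InfiniteAdeleRing K)ˣ in 𝓝 1, ∀ w : InfinitePlace K, ∀ hw : w.IsReal,
      0 < NumberField.InfinitePlace.Completion.extensionEmbeddingOfIsReal hw
        (((y : (InfiniteAdeleRing K)ˣ) : InfiniteAdeleRing K) w) := by
    refine Filter.eventually_all.mpr fun w => ?_
    by_cases hw : w.IsReal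
    · filter_upwards [key w hw] with y hy
      intro _
      exact hy
    · exact Filter.Eventually.of_forall fun y hw' => absurd hw' hw
  filter_upwards [hall] with y hy
  exact hy

/-- At a place `v ∤ ℓ`, an `ℓ`-adic idelic character is **trivial on the local units congruent to
`1` modulo a high power of `𝔭_v`** (`Ψ(⟨𝒪_vˣ⟩)` has finite exponent `N`,
`exists_pow_map_localUnits_eq_one_of_not_mem`; near `1` the values are within `‖ℓ‖` of `1`,
`exists_forall_valued_le_norm_sub_one_lt`; and `N`-torsion that close to `1` is trivial,
`PadicAlgCl.eq_one_of_pow_eq_one_of_norm_sub_one_lt`). [cite: SerreAbelianLadic1968, Ch. III §2.2] -/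
theorem exists_map_localUnits_eq_one_of_not_mem (Ψ : ideleGroup K →ₜ* (PadicAlgCl ℓ)ˣ)
    {v : HeightOneSpectrum (𝓞 K)} (hv : (ℓ : 𝓞 K) ∉ v.asIdeal) :
    ∃ e : ℕ, ∀ u : (v.adicCompletionIntegers K)ˣ,
      Valued.v (((u : v.adicCompletionIntegers K) : v.adicCompletion K) - 1) ≤
        WithZero.exp (-(e : ℤ)) →
      Ψ (localUnits v (Units.map ((v.adicCompletionIntegers K).subtype : _ →* _) u)) = 1 := by
  obtain ⟨N, hN, hNu⟩ := IdelicCharacter.exists_pow_map_localUnits_eq_one_of_not_mem Ψ hv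
  have hℓ0 : 0 < ‖(ℓ : PadicAlgCl ℓ)‖ := by
    rw [PadicAlgCl.norm_natCast_self]
    exact inv_pos.mpr (by exact_mod_cast (Fact.out : ℓ.Prime).pos)
  obtain ⟨e, he⟩ := IdelicCharacter.exists_forall_valued_le_norm_sub_one_lt Ψ v hℓ0
  refine ⟨e, fun u hu => Units.ext ?_⟩
  rw [Units.val_one]
  refine PadicAlgCl.eq_one_of_pow_eq_one_of_norm_sub_one_lt (he u hu) hN ?_
  rw [← Units.val_pow_eq_pow_val, hNu u, Units.val_one]

/-- **`Ψ♭ = 1` on a neighbourhood of `1` in `𝕀_K`** (so it is locally constant).  Hypotheses: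
`L ⊇ S_ℓ`, local algebraicity at `L`, and `Ψ(⟨𝒪_vˣ⟩) = 1` off a finite set.  The neighbourhood:
`x_∞` totally positive, `x_v ∈ 𝒪_vˣ` for all `v`, `x_v ≡ 1 mod 𝔭_v^m` on `L`, and
`x_v ≡ 1 mod 𝔭_v^{e_v}` at the finitely many ramified `v ∤ ℓ`; there
`Ψ(x) = Ψ((x_∞,1)) Ψ(i_L x) ∏_{v ramified, ∉ L} Ψ(⟨x_v⟩) Ψ(z) = Ψ(i_L x)` (`z` supported on units at
unramified places, `IdelicCharacter.map_eq_one_of_forall_valued_eq_one`) and `corr(x) = 1`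
(`k = 1` approximates). [cite: SerreAbelianLadic1968, Ch. II §2.7] -/
theorem eventually_flatFun_eq_one {hm : 0 < m} (hLA : ∀ k : Kˣ, (∀ v ∈ L, Valued.v (algebraMap K (v.adicCompletion K) (k : K) - 1) ≤
        WithZero.exp (-(m : ℤ))) →
      (∏ v ∈ L, ((Ψ (localUnits v (globalToLocalUnits v k)) : (PadicAlgCl ℓ)ˣ) : PadicAlgCl ℓ)) =
        ∏ τ : K →+* PadicAlgCl ℓ, τ (k : K) ^ (-(n τ)))
    (hL : ∀ v : HeightOneSpectrum (𝓞 K), (ℓ : 𝓞 K) ∈ v.asIdeal → v ∈ L)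
    (hunr : ∀ᶠ v : HeightOneSpectrum (𝓞 K) in cofinite, ∀ u : (v.adicCompletionIntegers K)ˣ,
      Ψ (localUnits v (Units.map ((v.adicCompletionIntegers K).subtype : _ →* _) u)) = 1) :
    ∀ᶠ x in 𝓝 (1 : ideleGroup K), flatFun Ψ L n m hm x = 1 := by
  classical
  rw [Filter.eventually_cofinite] at hunr
  set T : Finset (HeightOneSpectrum (𝓞 K)) := hunr.toFinset with hT
  have hTc : ∀ v ∉ T, ∀ u : (v.adicCompletionIntegers K)ˣ,
      Ψ (localUnits v (Units.map ((v.adicCompletionIntegers K).subtype : _ →* _) u)) = 1 := by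
    intro v hv
    by_contra h
    exact hv (hunr.mem_toFinset.mpr h)
  -- levels at the ramified places away from `ℓ`
  have key : ∀ v : HeightOneSpectrum (𝓞 K), ∃ e : ℕ, (ℓ : 𝓞 K) ∉ v.asIdeal →
      ∀ u : (v.adicCompletionIntegers K)ˣ,
        Valued.v (((u : v.adicCompletionIntegers K) : v.adicCompletion K) - 1) ≤
          WithZero.exp (-(e : ℤ)) →
        Ψ (localUnits v (Units.map ((v.adicCompletionIntegers K).subtype : _ →* _) u)) = 1 := by
    intro v
    by_cases hv : (ℓ : 𝓞 K) ∈ v.asIdeal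
    · exact ⟨0, fun h => absurd hv h⟩
    · obtain ⟨e, he⟩ := exists_map_localUnits_eq_one_of_not_mem Ψ hv
      exact ⟨e, fun _ => he⟩
  choose e he using key
  -- the four neighbourhood conditions
  have hinf : ∀ᶠ x in 𝓝 (1 : ideleGroup K),
      InfiniteIdele.IsTotallyPositive (HeckeCharacter.infPart K x) := by
    have hc := (HeckeCharacter.continuous_infPart (K := K)).continuousAt (x := (1 : ideleGroup K))
    rw [ContinuousAt, map_one] at hc
    exact hc.eventually eventually_isTotallyPositive
  have hU : ∀ᶠ x in 𝓝 (1 : ideleGroup K), x ∈ unitIdeles K :=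
    (isOpen_unitIdeles K).mem_nhds (unitIdeles K).one_mem
  have hball : ∀ (v : HeightOneSpectrum (𝓞 K)) (r : ℕ), ∀ᶠ x : ideleGroup K in 𝓝 1,
      Valued.v (((x : ideleGroup K) : AdeleRing (𝓞 K) K).2 v - 1) < WithZero.exp (-(r : ℤ)) := by
    intro v r
    have hc := continuous_ideleGroup_snd_apply (K := K) v
    have h1 : {c : v.adicCompletion K | Valued.v (c - 1) < WithZero.exp (-(r : ℤ))} ∈
        𝓝 (((1 : ideleGroup K) : AdeleRing (𝓞 K) K).2 v) :=
      adicCompletion_setOf_valued_sub_one_lt_mem_nhds (K := K) v r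
    exact (hc.continuousAt (x := (1 : ideleGroup K))).preimage_mem_nhds h1
  have hLb : ∀ᶠ x : ideleGroup K in 𝓝 1, ∀ v ∈ L,
      Valued.v (((x : ideleGroup K) : AdeleRing (𝓞 K) K).2 v - 1) < WithZero.exp (-(m : ℤ)) :=
    (Filter.eventually_all_finset L).mpr fun v _ => hball v m
  have hTb : ∀ᶠ x : ideleGroup K in 𝓝 1, ∀ v ∈ T,
      Valued.v (((x : ideleGroup K) : AdeleRing (𝓞 K) K).2 v - 1) < WithZero.exp (-(e v : ℤ)) :=
    (Filter.eventually_all_finset T).mpr fun v _ => hball v (e v)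
  filter_upwards [hinf, hU, hLb, hTb] with x hxinf hxU hxL hxT
  -- components of `x` as local units
  have hxu : ∀ v, Valued.v ((x : AdeleRing (𝓞 K) K).2 v) = 1 := hxU
  choose u hu using fun v => IdelicCharacter.exists_unitsMap_eq_of_valued_eq_one (ideleCpt v x) (hxu v)
  -- the decomposition `x = (x_∞,1) · ∏_{v ∈ T ∪ L} ⟨x_v⟩ · z`
  set F : Finset (HeightOneSpectrum (𝓞 K)) := T ∪ L with hF
  set I : ideleGroup K := infiniteIdeles K (HeckeCharacter.infPart K x) with hI
  set G : ideleGroup K := ∏ v ∈ F, localUnits v (ideleCpt v x) with hG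
  set z : ideleGroup K := (I * G)⁻¹ * x with hz
  have hΨz : Ψ z = 1 := by
    refine IdelicCharacter.map_eq_one_of_forall_valued_eq_one Ψ (S := (F : Set _))
      (fun v hv => hTc v fun h => hv (Finset.mem_coe.mpr (Finset.mem_union_left _ h))) z ?_ ?_ ?_
    · rw [hz, ideleGroup_val_fst_mul]
      have h1 := ideleGroup_val_inv_fst_mul (I * G)
      rwa [ideleGroup_val_fst_mul, hI, infiniteIdeles_fst, hG, fst_prod_localUnits, mul_one,
        HeckeCharacter.val_infPart] at h1
    · intro v hv
      have hv' : v ∈ F := Finset.mem_coe.mp hv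
      rw [hz, ideleGroup_val_snd_mul, ideleGroup_val_inv_snd, ideleGroup_val_snd_mul, hI,
        infiniteIdeles_snd, one_mul, hG, snd_prod_localUnits, if_pos hv', val_ideleCpt,
        inv_mul_cancel₀ (ideleGroup_snd_ne_zero x v)]
    · intro v
      rw [hz, ideleGroup_val_snd_mul, ideleGroup_val_inv_snd, ideleGroup_val_snd_mul, hI,
        infiniteIdeles_snd, one_mul, hG, snd_prod_localUnits]
      split_ifs with hv
      · rw [val_ideleCpt, inv_mul_cancel₀ (ideleGroup_snd_ne_zero x v), map_one]
      · rw [inv_one, one_mul]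
        exact hxu v
  have hxdec : x = I * G * z := by rw [hz, mul_inv_cancel_left]
  -- `Ψ(I) = 1`
  have hΨI : Ψ I = 1 := map_infiniteIdeles_eq_one_of_isTotallyPositive Ψ hxinf
  -- `Ψ(G) = Ψ(i_L x)`: the factors at the ramified `v ∉ L` die
  have hΨG : Ψ G = Ψ (ellIdele L x) := by
    have hFL : F = L ∪ (T \ L) := by
      rw [hF, Finset.union_sdiff_self_eq_union, Finset.union_comm]
    rw [hG, hFL, Finset.prod_union Finset.disjoint_sdiff, map_mul]
    have h2 : Ψ (∏ v ∈ T \ L, localUnits v (ideleCpt v x)) = 1 := by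
      rw [map_prod]
      refine Finset.prod_eq_one fun v hv => ?_
      rw [Finset.mem_sdiff] at hv
      have hvℓ : (ℓ : 𝓞 K) ∉ v.asIdeal := fun h => hv.2 (hL v h)
      have hcong : Valued.v (((u v : v.adicCompletionIntegers K) : v.adicCompletion K) - 1) ≤
          WithZero.exp (-(e v : ℤ)) := by
        have hux : ((u v : v.adicCompletionIntegers K) : v.adicCompletion K) =
            (x : AdeleRing (𝓞 K) K).2 v := by
          have := congrArg (fun w : (v.adicCompletion K)ˣ => (w : v.adicCompletion K)) (hu v)
          simpa using this
        rw [hux]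
        exact (hxT v hv.1).le
      rw [← hu v]
      exact he v hvℓ (u v) hcong
    rw [h2, mul_one]
    rfl
  -- so `Ψ(x) = Ψ(i_L x)` and `corr x = 1`
  have hΨx : Ψ x = Ψ (ellIdele L x) := by
    have h := congrArg Ψ hxdec
    rwa [map_mul, map_mul, hΨI, hΨG, hΨz, one_mul, mul_one] at h
  have hclose : IsClose L m x 1 := isClose_one_of_valued_sub_one_le hm fun v hv => (hxL v hv).le
  rw [flatFun, hΨx, mul_inv_cancel₀ (Units.ne_zero _), one_mul]
  exact corr_eq_one_of_isClose_one hLA hclose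

end Flat

/-! ### §5. The Hecke character of a locally algebraic idelic character -/

section Hecke

variable (n : (K →+* PadicAlgCl ℓ) → ℤ) (ι : PadicAlgCl ℓ ≃+* ℂ)

/-- The exponents transported to the complex embeddings along `ι`: `n'_φ = n_{ι⁻¹ ∘ φ}`. [folklore] -/
def cxExponent : (K →+* ℂ) → ℤ := fun φ => n ((ι.symm : ℂ ≃+* PadicAlgCl ℓ).toRingHom.comp φ)

/-- **`ι(∏_τ τ(k)^{n_τ}) = ∏_φ φ(k)^{n'_φ}`** (reindexing the embeddings by `τ ↦ ι ∘ τ`). [folklore] -/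
theorem map_algFactor (k : Kˣ) : ι (algFactor n k) = ∏ φ : K →+* ℂ, φ (k : K) ^ cxExponent n ι φ := by
  rw [algFactor, map_prod]
  simp only [map_zpow₀]
  let e : (K →+* PadicAlgCl ℓ) ≃ (K →+* ℂ) :=
    { toFun := fun τ => (ι : PadicAlgCl ℓ ≃+* ℂ).toRingHom.comp τ
      invFun := fun φ => (ι.symm : ℂ ≃+* PadicAlgCl ℓ).toRingHom.comp φ
      left_inv := fun τ => RingHom.ext fun x => by simp
      right_inv := fun φ => RingHom.ext fun x => by simp }
  refine Fintype.prod_equiv e _ _ fun τ => ?_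
  have h1 : cxExponent n ι (e τ) = n τ := by
    change n ((ι.symm : ℂ ≃+* PadicAlgCl ℓ).toRingHom.comp ((ι : PadicAlgCl ℓ ≃+* ℂ).toRingHom.comp τ)) = n τ
    congr 1
    exact RingHom.ext fun x => by simp
  rw [h1]
  rfl

/-- The infinity type `(p, q)` attached to the exponents `n` and `ι` (tree
`HeckeCharacter.typeOfExponent`). [folklore] -/
def locAlgType : (InfinitePlace K → ℤ) × (InfinitePlace K → ℤ) :=
  HeckeCharacter.typeOfExponent (cxExponent n ι)

variable {Ψ : ideleGroup K →ₜ* (PadicAlgCl ℓ)ˣ} {L : Finset (HeightOneSpectrum (𝓞 K))}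
  {n} {m : ℕ} {hm : 0 < m}

/-- `ι ∘ Ψ♭` as a character `𝕀_K →* ℂˣ`. [folklore] -/
def flatHom (hLA : ∀ k : Kˣ, (∀ v ∈ L, Valued.v (algebraMap K (v.adicCompletion K) (k : K) - 1) ≤
        WithZero.exp (-(m : ℤ))) →
      (∏ v ∈ L, ((Ψ (localUnits v (globalToLocalUnits v k)) : (PadicAlgCl ℓ)ˣ) : PadicAlgCl ℓ)) =
        ∏ τ : K →+* PadicAlgCl ℓ, τ (k : K) ^ (-(n τ))) (ι : PadicAlgCl ℓ ≃+* ℂ) : ideleGroup K →* ℂˣ where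
  toFun x := Units.mk0 (ι (flatFun Ψ L n m hm x)) ((_root_.map_ne_zero ι).mpr (flatFun_ne_zero hm x))
  map_one' := Units.ext (by rw [Units.val_mk0, flatFun_one hLA, map_one, Units.val_one])
  map_mul' x y := Units.ext (by
    simp only [Units.val_mk0, Units.val_mul, flatFun_mul hLA, map_mul])

/-- Unfolding `flatHom`. [folklore] -/
@[simp] theorem coe_flatHom_apply (hLA : ∀ k : Kˣ, (∀ v ∈ L, Valued.v (algebraMap K (v.adicCompletion K) (k : K) - 1) ≤
        WithZero.exp (-(m : ℤ))) →
      (∏ v ∈ L, ((Ψ (localUnits v (globalToLocalUnits v k)) : (PadicAlgCl ℓ)ˣ) : PadicAlgCl ℓ)) =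
        ∏ τ : K →+* PadicAlgCl ℓ, τ (k : K) ^ (-(n τ))) (x : ideleGroup K) :
    (flatHom (hm := hm) hLA ι x : ℂ) = ι (flatFun Ψ L n m hm x) := rfl

/-- **`ι ∘ Ψ♭` is continuous**: it is `1` on a neighbourhood of `1` (`eventually_flatFun_eq_one`),
and a homomorphism of topological groups continuous at `1` is continuous. [folklore] -/
theorem continuous_flatHom (hLA : ∀ k : Kˣ, (∀ v ∈ L, Valued.v (algebraMap K (v.adicCompletion K) (k : K) - 1) ≤
        WithZero.exp (-(m : ℤ))) →
      (∏ v ∈ L, ((Ψ (localUnits v (globalToLocalUnits v k)) : (PadicAlgCl ℓ)ˣ) : PadicAlgCl ℓ)) =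
        ∏ τ : K →+* PadicAlgCl ℓ, τ (k : K) ^ (-(n τ)))
    (hL : ∀ v : HeightOneSpectrum (𝓞 K), (ℓ : 𝓞 K) ∈ v.asIdeal → v ∈ L)
    (hunr : ∀ᶠ v : HeightOneSpectrum (𝓞 K) in cofinite, ∀ u : (v.adicCompletionIntegers K)ˣ,
      Ψ (localUnits v (Units.map ((v.adicCompletionIntegers K).subtype : _ →* _) u)) = 1) :
    Continuous (flatHom (hm := hm) hLA ι) := by
  refine continuous_of_continuousAt_one (flatHom (hm := hm) hLA ι) ?_
  have key : (fun _ : ideleGroup K => (1 : ℂˣ)) =ᶠ[𝓝 1] (flatHom (hm := hm) hLA ι : ideleGroup K → ℂˣ) := by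
    filter_upwards [eventually_flatFun_eq_one (hm := hm) hLA hL hunr] with x hx
    exact Units.ext (by rw [coe_flatHom_apply, hx, map_one, Units.val_one])
  have h1 : ContinuousAt (fun _ : ideleGroup K => (1 : ℂˣ)) 1 := continuousAt_const
  have h2 := h1.congr key
  rwa [ContinuousAt, map_one] at h2 ⊢

/-- The monoid homomorphism `x ↦ ι(Ψ♭(x)) · A_{p,q}(x_∞)` underlying the Hecke character. [folklore] -/
def locAlgHom (hLA : ∀ k : Kˣ, (∀ v ∈ L, Valued.v (algebraMap K (v.adicCompletion K) (k : K) - 1) ≤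
        WithZero.exp (-(m : ℤ))) →
      (∏ v ∈ L, ((Ψ (localUnits v (globalToLocalUnits v k)) : (PadicAlgCl ℓ)ˣ) : PadicAlgCl ℓ)) =
        ∏ τ : K →+* PadicAlgCl ℓ, τ (k : K) ^ (-(n τ))) (ι : PadicAlgCl ℓ ≃+* ℂ) : ideleGroup K →* ℂˣ :=
  flatHom (hm := hm) hLA ι * HeckeCharacter.archIdeleChar (locAlgType n ι).1 (locAlgType n ι).2

/-- Unfolding `locAlgHom`. [folklore] -/
theorem coe_locAlgHom_apply (hLA : ∀ k : Kˣ, (∀ v ∈ L, Valued.v (algebraMap K (v.adicCompletion K) (k : K) - 1) ≤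
        WithZero.exp (-(m : ℤ))) →
      (∏ v ∈ L, ((Ψ (localUnits v (globalToLocalUnits v k)) : (PadicAlgCl ℓ)ˣ) : PadicAlgCl ℓ)) =
        ∏ τ : K →+* PadicAlgCl ℓ, τ (k : K) ^ (-(n τ))) (x : ideleGroup K) :
    (locAlgHom (hm := hm) hLA ι x : ℂ) =
      ι (flatFun Ψ L n m hm x) *
        HeckeCharacter.archFactor (locAlgType n ι).1 (locAlgType n ι).2 (HeckeCharacter.infPart K x) := by
  rw [locAlgHom, MonoidHom.mul_apply, Units.val_mul, coe_flatHom_apply,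
    HeckeCharacter.coe_archIdeleChar_apply]

/-- `locAlgHom` is continuous. [folklore] -/
theorem continuous_locAlgHom (hLA : ∀ k : Kˣ, (∀ v ∈ L, Valued.v (algebraMap K (v.adicCompletion K) (k : K) - 1) ≤
        WithZero.exp (-(m : ℤ))) →
      (∏ v ∈ L, ((Ψ (localUnits v (globalToLocalUnits v k)) : (PadicAlgCl ℓ)ˣ) : PadicAlgCl ℓ)) =
        ∏ τ : K →+* PadicAlgCl ℓ, τ (k : K) ^ (-(n τ)))
    (hL : ∀ v : HeightOneSpectrum (𝓞 K), (ℓ : 𝓞 K) ∈ v.asIdeal → v ∈ L)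
    (hunr : ∀ᶠ v : HeightOneSpectrum (𝓞 K) in cofinite, ∀ u : (v.adicCompletionIntegers K)ˣ,
      Ψ (localUnits v (Units.map ((v.adicCompletionIntegers K).subtype : _ →* _) u)) = 1) :
    Continuous (locAlgHom (hm := hm) hLA ι) := by
  have h1 := continuous_flatHom (hm := hm) ι hLA hL hunr
  have h2 := HeckeCharacter.continuous_archIdeleChar (K := K) (locAlgType n ι).1 (locAlgType n ι).2
  exact h1.mul h2

/-- **`locAlgHom` kills the principal ideles**: `ι(∏_τ τ(k)^{n_τ}) · ∏_φ φ(k)^{-n'_φ} = 1`.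
[cite: Weil1956, §1] -/
theorem locAlgHom_principalIdele (hLA : ∀ k : Kˣ, (∀ v ∈ L, Valued.v (algebraMap K (v.adicCompletion K) (k : K) - 1) ≤
        WithZero.exp (-(m : ℤ))) →
      (∏ v ∈ L, ((Ψ (localUnits v (globalToLocalUnits v k)) : (PadicAlgCl ℓ)ˣ) : PadicAlgCl ℓ)) =
        ∏ τ : K →+* PadicAlgCl ℓ, τ (k : K) ^ (-(n τ)))
    (hK : ∀ x ∈ principalIdeles K, Ψ x = 1) (k : Kˣ) :
    locAlgHom (hm := hm) hLA ι (principalIdele K k) = 1 := by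
  apply Units.ext
  rw [coe_locAlgHom_apply, flatFun_principalIdele hLA hK, map_algFactor,
    HeckeCharacter.infPart_principalIdele, locAlgType,
    HeckeCharacter.archFactor_globalToInfiniteUnits_eq_prod_embeddings, Units.val_one,
    ← Finset.prod_mul_distrib]
  refine Finset.prod_eq_one fun φ _ => ?_
  rw [HeckeCharacter.embExponent_typeOfExponent, zpow_neg,
    mul_inv_cancel₀ (zpow_ne_zero _ ((_root_.map_ne_zero φ).mpr k.ne_zero))]

/-- **The Hecke character `χ₀` of a locally algebraic idelic `ℓ`-adic character**
(`x ↦ ι(Ψ♭(x)) · A_{p,q}(x_∞)`). [cite: SerreAbelianLadic1968, Ch. III §2.3 Thm. 2] -/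
def heckeOfLocAlg (hLA : ∀ k : Kˣ, (∀ v ∈ L, Valued.v (algebraMap K (v.adicCompletion K) (k : K) - 1) ≤
        WithZero.exp (-(m : ℤ))) →
      (∏ v ∈ L, ((Ψ (localUnits v (globalToLocalUnits v k)) : (PadicAlgCl ℓ)ˣ) : PadicAlgCl ℓ)) =
        ∏ τ : K →+* PadicAlgCl ℓ, τ (k : K) ^ (-(n τ))) (hK : ∀ x ∈ principalIdeles K, Ψ x = 1)
    (hL : ∀ v : HeightOneSpectrum (𝓞 K), (ℓ : 𝓞 K) ∈ v.asIdeal → v ∈ L)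
    (hunr : ∀ᶠ v : HeightOneSpectrum (𝓞 K) in cofinite, ∀ u : (v.adicCompletionIntegers K)ˣ,
      Ψ (localUnits v (Units.map ((v.adicCompletionIntegers K).subtype : _ →* _) u)) = 1)
    (ι : PadicAlgCl ℓ ≃+* ℂ) : HeckeCharacter K where
  toContinuousMonoidHom :=
    { locAlgHom (hm := hm) hLA ι with continuous_toFun := continuous_locAlgHom ι hLA hL hunr }
  map_principal' := by
    rintro x ⟨k, rfl⟩
    exact locAlgHom_principalIdele ι hLA hK k

variable {hLA : ∀ k : Kˣ, (∀ v ∈ L, Valued.v (algebraMap K (v.adicCompletion K) (k : K) - 1) ≤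
        WithZero.exp (-(m : ℤ))) →
      (∏ v ∈ L, ((Ψ (localUnits v (globalToLocalUnits v k)) : (PadicAlgCl ℓ)ˣ) : PadicAlgCl ℓ)) =
        ∏ τ : K →+* PadicAlgCl ℓ, τ (k : K) ^ (-(n τ))} {hK : ∀ x ∈ principalIdeles K, Ψ x = 1}
  {hL : ∀ v : HeightOneSpectrum (𝓞 K), (ℓ : 𝓞 K) ∈ v.asIdeal → v ∈ L}
  {hunr : ∀ᶠ v : HeightOneSpectrum (𝓞 K) in cofinite, ∀ u : (v.adicCompletionIntegers K)ˣ,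
      Ψ (localUnits v (Units.map ((v.adicCompletionIntegers K).subtype : _ →* _) u)) = 1}

/-- Unfolding `heckeOfLocAlg`. [folklore] -/
theorem heckeOfLocAlg_apply (x : ideleGroup K) :
    ((heckeOfLocAlg (hm := hm) hLA hK hL hunr ι) x : ℂ) =
      ι (flatFun Ψ L n m hm x) *
        HeckeCharacter.archFactor (locAlgType n ι).1 (locAlgType n ι).2 (HeckeCharacter.infPart K x) :=
  coe_locAlgHom_apply ι hLA x

/-- **`χ₀` has infinity type `(p, q)`**: on totally positive `y ∈ (K ⊗ ℝ)ˣ`,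
`χ₀((y,1)) = ι(Ψ((y,1))) A_{p,q}(y) = A_{p,q}(y)`. [cite: Weil1956, §1] -/
theorem hasInfinityType_heckeOfLocAlg :
    (heckeOfLocAlg (hm := hm) hLA hK hL hunr ι).HasInfinityType (locAlgType n ι).1 (locAlgType n ι).2 := by
  refine ⟨{y | InfiniteIdele.IsTotallyPositive y}, eventually_isTotallyPositive, fun y hy => ?_⟩
  rw [heckeOfLocAlg_apply, flatFun_infiniteIdeles hLA, map_infiniteIdeles_eq_one_of_isTotallyPositive Ψ hy,
    Units.val_one, map_one, one_mul, HeckeCharacter.infPart_infiniteIdeles]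

/-- `χ₀` is algebraic. [cite: Weil1956, §1] -/
theorem isAlgebraic_heckeOfLocAlg : (heckeOfLocAlg (hm := hm) hLA hK hL hunr ι).IsAlgebraic :=
  (HeckeCharacter.isAlgebraic_iff_exists_hasInfinityType _).mpr ⟨_, _, hasInfinityType_heckeOfLocAlg ι⟩

/-- The local components of `χ₀` away from `L`: `χ₀(⟨u⟩_v) = ι(Ψ(⟨u⟩_v))`. [folklore] -/
theorem localComponent_heckeOfLocAlg {v : HeightOneSpectrum (𝓞 K)} (hv : v ∉ L)
    (u : (v.adicCompletion K)ˣ) :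
    ((heckeOfLocAlg (hm := hm) hLA hK hL hunr ι).localComponent v u : ℂ) =
      ι ((Ψ (localUnits v u) : (PadicAlgCl ℓ)ˣ) : PadicAlgCl ℓ) := by
  have h1 : HeckeCharacter.infPart K (localUnits v u) = 1 := Units.ext (localUnits_fst v u)
  rw [HeckeCharacter.localComponent_apply, heckeOfLocAlg_apply, flatFun_localUnits hLA hv, h1, map_one,
    mul_one]

/-- `χ₀` is unramified at every `v ∉ L` where `Ψ` kills `𝒪_vˣ`. [folklore] -/
theorem isUnramifiedAt_heckeOfLocAlg {v : HeightOneSpectrum (𝓞 K)} (hv : v ∉ L)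
    (hΨv : ∀ u : (v.adicCompletionIntegers K)ˣ,
      Ψ (localUnits v (Units.map ((v.adicCompletionIntegers K).subtype : _ →* _) u)) = 1) :
    (heckeOfLocAlg (hm := hm) hLA hK hL hunr ι).IsUnramifiedAt v := by
  intro u
  apply Units.ext
  rw [localComponent_heckeOfLocAlg ι hv, hΨv u, Units.val_one, map_one, Units.val_one]

/-- **`χ₀(ϖ_v) = ι(Ψ(⟨ϖ_v⟩_v))`** at `v ∉ L`. [folklore] -/
theorem valueAtUniformizer_heckeOfLocAlg {v : HeightOneSpectrum (𝓞 K)} (hv : v ∉ L) :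
    (heckeOfLocAlg (hm := hm) hLA hK hL hunr ι).valueAtUniformizer v =
      ι ((Ψ (localUnits v (HeckeCharacter.uniformizer K v)) : (PadicAlgCl ℓ)ˣ) : PadicAlgCl ℓ) :=
  localComponent_heckeOfLocAlg ι hv _

end Hecke

/-! ### §6. The theorem -/

/-- Raising the level preserves local algebraicity at `L`. [folklore] -/
theorem locAlg_mono {Ψ : ideleGroup K →ₜ* (PadicAlgCl ℓ)ˣ} {L : Finset (HeightOneSpectrum (𝓞 K))}
    {n : (K →+* PadicAlgCl ℓ) → ℤ} {m m' : ℕ}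
    (h : ∀ k : Kˣ, (∀ v ∈ L, Valued.v (algebraMap K (v.adicCompletion K) (k : K) - 1) ≤
        WithZero.exp (-(m : ℤ))) →
      (∏ v ∈ L, ((Ψ (localUnits v (globalToLocalUnits v k)) : (PadicAlgCl ℓ)ˣ) : PadicAlgCl ℓ)) =
        ∏ τ : K →+* PadicAlgCl ℓ, τ (k : K) ^ (-(n τ))) (hmm' : m ≤ m') :
    ∀ k : Kˣ, (∀ v ∈ L, Valued.v (algebraMap K (v.adicCompletion K) (k : K) - 1) ≤
        WithZero.exp (-(m' : ℤ))) →
      (∏ v ∈ L, ((Ψ (localUnits v (globalToLocalUnits v k)) : (PadicAlgCl ℓ)ˣ) : PadicAlgCl ℓ)) =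
        ∏ τ : K →+* PadicAlgCl ℓ, τ (k : K) ^ (-(n τ)) := fun k hk =>
  h k fun v hv => (hk v hv).trans (WithZero.exp_le_exp.mpr (by omega))

/-- **Locally algebraic `ℓ`-adic characters come from algebraic Hecke characters** (Serre 1968,
Ch. III §2.3 Thm. 2 with Ch. II §2.7; Weil 1956; Böckle–Hui §2.4 (Loc-alg) ⇒ (E-SCS), §3.2.1).  Let
`ψ : Γ_K →ₜ* GL_1(ℚ̄_ℓ)` be continuous, `Ψ : 𝕀_K →ₜ* ℚ̄_ℓˣ` trivial on `Kˣ` with, at all but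
finitely many `v`, `ψ` unramified, `Ψ(⟨𝒪_vˣ⟩_v) = 1` and `ψ(Frob_v) = Ψ(⟨ϖ⟩_v)` for every `ϖ` of
valuation one (`Ψ = ψ ∘ Art_K`, tree `FramedGaloisRep.exists_idelicCharacter_eventually`); let
`L ⊇ S_ℓ` be finite and suppose `Ψ` locally algebraic at `L` with exponents `n` and level `m`
(hypothesis `hLA`: `∏_{v∈L} Ψ(⟨k⟩_v) = ∏_τ τ(k)^{-n_τ}` for `k ≡ 1 mod 𝔭_v^m`, `v ∈ L`).  Then for every
`ι : ℚ̄_ℓ ≃+* ℂ` there is an algebraic Hecke character `χ` of `K` such that at all but finitely many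
`v`: `χ` and `ψ` are unramified and `ψ.HasFrobCharpolyAt v (X - C (ι⁻¹(χ(ϖ_v))⁻¹))` — namely
`χ = χ₀⁻¹` for the character `χ₀` of §5.
[cite: SerreAbelianLadic1968, Ch. III §2.3 Thm. 2] [cite: BockleHui2025, §2.4 and §3.2.1] -/
theorem exists_heckeCharacter_of_isLocAlgAt (ψ : FramedGaloisRep K (PadicAlgCl ℓ) 1)
    (Ψ : ideleGroup K →ₜ* (PadicAlgCl ℓ)ˣ) (hK : ∀ x ∈ principalIdeles K, Ψ x = 1)
    (hΨ : ∀ᶠ v : HeightOneSpectrum (𝓞 K) in cofinite, ψ.IsUnramifiedAt v ∧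
      (∀ u : (v.adicCompletionIntegers K)ˣ,
          Ψ (localUnits v (Units.map ((v.adicCompletionIntegers K).subtype : _ →* _) u)) = 1) ∧
      ∀ ϖ : (v.adicCompletion K)ˣ, Valued.v (ϖ : v.adicCompletion K) = WithZero.exp (-1 : ℤ) →
        ψ.HasFrobCharpolyAt v
          (Polynomial.X - Polynomial.C ((Ψ (localUnits v ϖ) : (PadicAlgCl ℓ)ˣ) : PadicAlgCl ℓ)))
    (L : Finset (HeightOneSpectrum (𝓞 K)))
    (hL : ∀ v : HeightOneSpectrum (𝓞 K), (ℓ : 𝓞 K) ∈ v.asIdeal → v ∈ L)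
    (n : (K →+* PadicAlgCl ℓ) → ℤ) (m : ℕ) (hLA : ∀ k : Kˣ, (∀ v ∈ L, Valued.v (algebraMap K (v.adicCompletion K) (k : K) - 1) ≤
        WithZero.exp (-(m : ℤ))) →
      (∏ v ∈ L, ((Ψ (localUnits v (globalToLocalUnits v k)) : (PadicAlgCl ℓ)ˣ) : PadicAlgCl ℓ)) =
        ∏ τ : K →+* PadicAlgCl ℓ, τ (k : K) ^ (-(n τ))) (ι : PadicAlgCl ℓ ≃+* ℂ) :
    ∃ χ : HeckeCharacter K, χ.IsAlgebraic ∧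
      ∀ᶠ v : HeightOneSpectrum (𝓞 K) in cofinite, χ.IsUnramifiedAt v ∧ ψ.IsUnramifiedAt v ∧
        ψ.HasFrobCharpolyAt v (Polynomial.X - Polynomial.C (ι.symm (χ.valueAtUniformizer v)⁻¹)) := by
  -- raise the level to `m + 1 ≥ 1`
  have hLA' := locAlg_mono hLA (Nat.le_succ m)
  have hm : 0 < m + 1 := Nat.succ_pos m
  have hunr : ∀ᶠ v : HeightOneSpectrum (𝓞 K) in cofinite, ∀ u : (v.adicCompletionIntegers K)ˣ,
      Ψ (localUnits v (Units.map ((v.adicCompletionIntegers K).subtype : _ →* _) u)) = 1 :=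
    hΨ.mono fun v hv => hv.2.1
  set χ₀ : HeckeCharacter K := heckeOfLocAlg (hm := hm) hLA' hK hL hunr ι with hχ₀
  refine ⟨χ₀⁻¹, (isAlgebraic_heckeOfLocAlg (hm := hm) (hLA := hLA') (hK := hK) (hL := hL)
    (hunr := hunr) ι).inv, ?_⟩
  have hLc : ∀ᶠ v : HeightOneSpectrum (𝓞 K) in cofinite, v ∉ L :=
    L.finite_toSet.compl_mem_cofinite
  filter_upwards [hΨ, hLc] with v hv hvL
  obtain ⟨hψv, hΨu, hΨϖ⟩ := hv
  refine ⟨?_, hψv, ?_⟩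
  · rw [HeckeCharacter.isUnramifiedAt_inv_iff]
    exact isUnramifiedAt_heckeOfLocAlg (hm := hm) (hLA := hLA') (hK := hK) (hL := hL)
      (hunr := hunr) ι hvL hΨu
  · have h1 := hΨϖ (HeckeCharacter.uniformizer K v) (HeckeCharacter.valued_uniformizer v)
    rw [HeckeCharacter.valueAtUniformizer_inv, inv_inv, hχ₀,
      valueAtUniformizer_heckeOfLocAlg (hm := hm) (hLA := hLA') (hK := hK) (hL := hL) (hunr := hunr)
        ι hvL, RingEquiv.symm_apply_apply]
    exact h1

end Literature.NumberTheory.GaloisRepresentations
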